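import Mathlib
import HarnessLib

/-!
# Fibring an additive energy over a factor: the "Cauchy–Schwarz under the integral" count

For finite sets `B_Y, B_R, B_S` and integer-valued `φ` on `B_Y`, `ψ` on `B_R × B_S` we prove

> `#{(y, r, s, y', r', s') : φ y + ψ(r, s) = φ y' + ψ(r', s')}`
> `    ≤ #B_R · #{(r, y, s, y', s') : φ y + ψ(r, s) = φ y' + ψ(r, s')}`

(`FourierCount.card_filter_add_eq_add_le`). This is the combinatorial content of the standard
step `∫ |S_φ|² |S_ψ|² ≤ #B_R ∫ |S_φ|² Σ_r |S_{ψ(r,·)}|²` (Cauchy–Schwarz in `r` inside the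
exponential sum `S_ψ = Σ_r S_{ψ(r,·)}`, then positivity of `|S_φ|²` and orthogonality) used for
the fourth-moment / mixed-moment bounds in [Bernert2025, proof of Prop. 3] and
[BernertEtAl2024, proof of Prop. 3.1] towards the bounds on `N_λ(X)` of
`Literature.NumberTheory.DiophantineGeometry.AbcExceptionalSetBounds`. It is proved here with
finite Fourier analysis: sums of powers of `ζ = exp(2πi/q)` over `a < q` for a modulus `q`
exceeding all the differences involved (`FourierCount.sum_zeta_zpow_mul`,
`FourierCount.sum_norm_sq_eq`), so only `geom_sum_eq` and `IsPrimitiveRoot` are used.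

## References

* [Bernert2025] C. Bernert, *The exceptional set in the abc conjecture*, arXiv:2506.13364 (2025),
  proof of Proposition 3 (fourth moment bound (3.2)).
* [BernertEtAl2024] C. Bernert, T. Browning, J. D. Lichtman, J. Teräväinen, *Bounds on the
  exceptional set in the abc conjecture*, arXiv:2410.12234, proof of Proposition 3.1 (v1).
-/

noncomputable section

open Finset

namespace Literature.NumberTheory.DiophantineGeometry

namespace FourierCount

/-! ### Roots of unity and orthogonality -/

/-- `ζ_q = exp(2πi/q)`. [folklore] -/
def zeta (q : ℕ) : ℂ :=
  Complex.exp (2 * Real.pi * Complex.I / q)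

/-- `ζ_q ≠ 0`. [folklore] -/
theorem zeta_ne_zero (q : ℕ) : zeta q ≠ 0 :=
  Complex.exp_ne_zero _

/-- `ζ_q` is a primitive `q`-th root of unity. [folklore] -/
theorem isPrimitiveRoot_zeta {q : ℕ} (hq : q ≠ 0) : IsPrimitiveRoot (zeta q) q :=
  Complex.isPrimitiveRoot_exp q hq

/-- `conj ζ_q = ζ_q⁻¹`. [folklore] -/
theorem conj_zeta (q : ℕ) : (starRingEnd ℂ) (zeta q) = (zeta q)⁻¹ := by
  rw [zeta, ← Complex.exp_conj, ← Complex.exp_neg]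
  congr 1
  simp only [map_div₀, map_mul, Complex.conj_ofReal, Complex.conj_I, map_natCast, map_ofNat]
  ring

/-- `conj (ζ_q ^ n) = ζ_q ^ (-n)`. [folklore] -/
theorem conj_zeta_zpow (q : ℕ) (n : ℤ) : (starRingEnd ℂ) (zeta q ^ n) = zeta q ^ (-n) := by
  rw [map_zpow₀, conj_zeta, inv_zpow']

/-- **Orthogonality**: `Σ_{a < q} ζ_q^{a n} = q` if `q ∣ n` and `0` otherwise. [folklore] -/
theorem sum_zeta_zpow_mul {q : ℕ} (hq : 0 < q) (n : ℤ) :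
    ∑ a ∈ range q, zeta q ^ ((a : ℤ) * n) = if (q : ℤ) ∣ n then (q : ℂ) else 0 := by
  have hprim := isPrimitiveRoot_zeta hq.ne'
  simp_rw [mul_comm (_ : ℤ) n, zpow_mul, zpow_natCast]
  split_ifs with h
  · rw [(hprim.zpow_eq_one_iff_dvd n).mpr h]
    simp
  · have hne : zeta q ^ n ≠ 1 := fun h1 => h ((hprim.zpow_eq_one_iff_dvd n).mp h1)
    rw [geom_sum_eq hne, ← zpow_natCast, ← zpow_mul, mul_comm, zpow_mul, zpow_natCast,
      hprim.pow_eq_one, one_zpow, sub_self, zero_div]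

/-- For `|n| < q`: `q ∣ n ↔ n = 0`. [folklore] -/
theorem natCast_dvd_iff_eq_zero {q : ℕ} {n : ℤ} (hn : |n| < q) : (q : ℤ) ∣ n ↔ n = 0 := by
  refine ⟨fun h => Int.eq_zero_of_abs_lt_dvd h hn, ?_⟩
  rintro rfl
  exact dvd_zero _

/-- **The second moment of an exponential sum counts coincidences**: if all differences
`u k - u k'` (`k, k' ∈ s`) are smaller than `q` in absolute value, then
`Σ_{a<q} |Σ_{k ∈ s} ζ_q^{a · u k}|² = q · #{(k, k') ∈ s × s : u k = u k'}`. [folklore] -/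
theorem sum_norm_sq_eq {K : Type*} (s : Finset K) (u : K → ℤ) {q : ℕ} (hq : 0 < q)
    (hu : ∀ k ∈ s, ∀ k' ∈ s, |u k - u k'| < q) :
    ∑ a ∈ range q, ‖∑ k ∈ s, zeta q ^ ((a : ℤ) * u k)‖ ^ 2 =
      (q : ℝ) * ((s ×ˢ s).filter (fun p => u p.1 = u p.2)).card := by
  classical
  -- expand `|S|²` as a double sum, in `ℂ`
  have hexp : ∀ a : ℕ, ((‖∑ k ∈ s, zeta q ^ ((a : ℤ) * u k)‖ : ℂ)) ^ 2 =
      ∑ p ∈ s ×ˢ s, zeta q ^ ((a : ℤ) * (u p.2 - u p.1)) := by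
    intro a
    rw [← Complex.ofReal_pow, ← Complex.normSq_eq_norm_sq, Complex.normSq_eq_conj_mul_self,
      map_sum, sum_mul_sum, sum_product]
    refine sum_congr rfl fun k _ => sum_congr rfl fun k' _ => ?_
    rw [conj_zeta_zpow, ← zpow_add₀ (zeta_ne_zero q)]
    congr 1; ring
  -- sum over `a` and use orthogonality
  have hsum : ((∑ a ∈ range q, ‖∑ k ∈ s, zeta q ^ ((a : ℤ) * u k)‖ ^ 2 : ℝ) : ℂ) =
      ((q : ℝ) * (((s ×ˢ s).filter (fun p => u p.1 = u p.2)).card : ℝ) : ℂ) := by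
    push_cast
    simp_rw [hexp]
    rw [sum_comm]
    have h1 : ∀ p ∈ s ×ˢ s, ∑ a ∈ range q, zeta q ^ ((a : ℤ) * (u p.2 - u p.1)) =
        if u p.1 = u p.2 then (q : ℂ) else 0 := by
      intro p hp
      rw [sum_zeta_zpow_mul hq]
      obtain ⟨h1, h2⟩ := mem_product.mp hp
      have hiff : (q : ℤ) ∣ (u p.2 - u p.1) ↔ u p.1 = u p.2 := by
        rw [natCast_dvd_iff_eq_zero (hu _ h2 _ h1), sub_eq_zero, eq_comm]
      simp only [hiff]
    rw [sum_congr rfl h1, ← sum_filter, sum_const, nsmul_eq_mul, mul_comm]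
  exact_mod_cast hsum

/-! ### The fibring inequality -/

/-- **Cauchy–Schwarz under the integral, combinatorial form.** For finite sets `B_Y, B_R, B_S`
and integer-valued `φ`, `ψ`:
`#{(y,(r,s),y',(r',s')) : φ y + ψ r s = φ y' + ψ r' s'} ≤ #B_R · #{(r,(y,s),(y',s')) : φ y + ψ r s = φ y' + ψ r s'}`.
(From `|Σ_r S_r|² ≤ #B_R Σ_r |S_r|²` pointwise, multiplied by `|S_φ|² ≥ 0` and summed over the
`q`-th roots of unity, `sum_norm_sq_eq`.) [folklore] -/
theorem card_filter_add_eq_add_le {α β γ : Type*} (BY : Finset α) (BR : Finset β)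
    (BS : Finset γ) (φ : α → ℤ) (ψ : β → γ → ℤ) :
    (((BY ×ˢ (BR ×ˢ BS)) ×ˢ (BY ×ˢ (BR ×ˢ BS))).filter
        (fun t => φ t.1.1 + ψ t.1.2.1 t.1.2.2 = φ t.2.1 + ψ t.2.2.1 t.2.2.2)).card ≤
      BR.card * ((BR ×ˢ ((BY ×ˢ BS) ×ˢ (BY ×ˢ BS))).filter
        (fun t => φ t.2.1.1 + ψ t.1 t.2.1.2 = φ t.2.2.1 + ψ t.1 t.2.2.2)).card := by
  classical
  -- the phase functions
  set u : α × β × γ → ℤ := fun k => φ k.1 + ψ k.2.1 k.2.2 with hu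
  set u' : β → α × γ → ℤ := fun r k => φ k.1 + ψ r k.2 with hu'
  -- a modulus exceeding all differences
  set W : ℕ := ∑ y ∈ BY, (φ y).natAbs + ∑ p ∈ BR ×ˢ BS, (ψ p.1 p.2).natAbs with hW
  set q : ℕ := 4 * W + 1 with hqdef
  have hq : 0 < q := Nat.succ_pos _
  have hφW : ∀ y ∈ BY, |φ y| ≤ W := by
    intro y hy
    have h1 : (φ y).natAbs ≤ ∑ y ∈ BY, (φ y).natAbs :=
      single_le_sum (f := fun y => (φ y).natAbs) (fun _ _ => Nat.zero_le _) hy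
    rw [Int.abs_eq_natAbs, hW]; exact_mod_cast h1.trans (Nat.le_add_right _ _)
  have hψW : ∀ r ∈ BR, ∀ s ∈ BS, |ψ r s| ≤ W := by
    intro r hr s hs
    have h1 : (ψ r s).natAbs ≤ ∑ p ∈ BR ×ˢ BS, (ψ p.1 p.2).natAbs :=
      single_le_sum (f := fun p : β × γ => (ψ p.1 p.2).natAbs) (a := (r, s))
        (fun _ _ => Nat.zero_le _) (mem_product.mpr ⟨hr, hs⟩)
    rw [Int.abs_eq_natAbs, hW]; exact_mod_cast h1.trans (Nat.le_add_left _ _)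
  -- all differences of phases are `< q`
  have hu_lt : ∀ k ∈ BY ×ˢ (BR ×ˢ BS), ∀ k' ∈ BY ×ˢ (BR ×ˢ BS), |u k - u k'| < q := by
    intro k hk k' hk'
    simp only [mem_product] at hk hk'
    have h1 := hφW _ hk.1; have h2 := hψW _ hk.2.1 _ hk.2.2
    have h3 := hφW _ hk'.1; have h4 := hψW _ hk'.2.1 _ hk'.2.2
    simp only [hu]
    rw [abs_lt]
    have := abs_le.mp h1; have := abs_le.mp h2; have := abs_le.mp h3; have := abs_le.mp h4
    constructor <;> push_cast [hqdef] <;> linarith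
  have hu'_lt : ∀ r ∈ BR, ∀ k ∈ BY ×ˢ BS, ∀ k' ∈ BY ×ˢ BS, |u' r k - u' r k'| < q := by
    intro r hr k hk k' hk'
    simp only [mem_product] at hk hk'
    have h1 := hφW _ hk.1; have h2 := hψW _ hr _ hk.2
    have h3 := hφW _ hk'.1; have h4 := hψW _ hr _ hk'.2
    simp only [hu']
    rw [abs_lt]
    have := abs_le.mp h1; have := abs_le.mp h2; have := abs_le.mp h3; have := abs_le.mp h4
    constructor <;> push_cast [hqdef] <;> linarith
  -- the exponential sums
  set F : ℕ → ℂ := fun a => ∑ y ∈ BY, zeta q ^ ((a : ℤ) * φ y) with hF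
  set G : ℕ → β → ℂ := fun a r => ∑ s ∈ BS, zeta q ^ ((a : ℤ) * ψ r s) with hG
  have hS : ∀ a : ℕ, ∑ k ∈ BY ×ˢ (BR ×ˢ BS), zeta q ^ ((a : ℤ) * u k) =
      F a * ∑ r ∈ BR, G a r := by
    intro a
    simp only [hF, hG]
    rw [sum_mul_sum, sum_product]
    refine sum_congr rfl fun y _ => ?_
    rw [sum_product]
    refine sum_congr rfl fun r _ => ?_
    rw [mul_sum]
    refine sum_congr rfl fun s _ => ?_
    rw [← zpow_add₀ (zeta_ne_zero q)]
    congr 1; simp only [hu]; ring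
  have hS' : ∀ (a : ℕ) (r : β), ∑ k ∈ BY ×ˢ BS, zeta q ^ ((a : ℤ) * u' r k) = F a * G a r := by
    intro a r
    simp only [hF, hG]
    rw [sum_mul_sum, sum_product]
    refine sum_congr rfl fun y _ => sum_congr rfl fun s _ => ?_
    rw [← zpow_add₀ (zeta_ne_zero q)]
    congr 1; simp only [hu']; ring
  -- pointwise Cauchy–Schwarz in `r`
  have hCS : ∀ a : ℕ, ‖F a * ∑ r ∈ BR, G a r‖ ^ 2 ≤ BR.card * ∑ r ∈ BR, ‖F a * G a r‖ ^ 2 := by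
    intro a
    rw [norm_mul, mul_pow]
    have h1 : ‖∑ r ∈ BR, G a r‖ ^ 2 ≤ BR.card * ∑ r ∈ BR, ‖G a r‖ ^ 2 :=
      calc ‖∑ r ∈ BR, G a r‖ ^ 2 ≤ (∑ r ∈ BR, ‖G a r‖) ^ 2 :=
            pow_le_pow_left₀ (norm_nonneg _) (norm_sum_le _ _) 2
        _ ≤ BR.card * ∑ r ∈ BR, ‖G a r‖ ^ 2 := sq_sum_le_card_mul_sum_sq
    calc ‖F a‖ ^ 2 * ‖∑ r ∈ BR, G a r‖ ^ 2 ≤ ‖F a‖ ^ 2 * (BR.card * ∑ r ∈ BR, ‖G a r‖ ^ 2) :=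
          mul_le_mul_of_nonneg_left h1 (sq_nonneg _)
      _ = BR.card * ∑ r ∈ BR, ‖F a * G a r‖ ^ 2 := by
          rw [mul_sum, mul_sum, mul_sum]
          refine sum_congr rfl fun r _ => ?_
          rw [norm_mul, mul_pow]; ring
  -- the two second-moment identities
  have hL := sum_norm_sq_eq (BY ×ˢ (BR ×ˢ BS)) u hq hu_lt
  have hRr : ∀ r ∈ BR, ∑ a ∈ range q, ‖F a * G a r‖ ^ 2 =
      (q : ℝ) * (((BY ×ˢ BS) ×ˢ (BY ×ˢ BS)).filter (fun p => u' r p.1 = u' r p.2)).card := by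
    intro r hr
    rw [← sum_norm_sq_eq (BY ×ˢ BS) (u' r) hq (hu'_lt r hr)]
    exact sum_congr rfl fun a _ => by rw [hS' a r]
  -- the right-hand count, fibred over `r`
  have hRcount : (((BR ×ˢ ((BY ×ˢ BS) ×ˢ (BY ×ˢ BS))).filter
      (fun t => φ t.2.1.1 + ψ t.1 t.2.1.2 = φ t.2.2.1 + ψ t.1 t.2.2.2)).card : ℝ) =
      ∑ r ∈ BR, ((((BY ×ˢ BS) ×ˢ (BY ×ˢ BS)).filter (fun p => u' r p.1 = u' r p.2)).card : ℝ) := by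
    rw [card_filter, sum_product]
    push_cast
    refine sum_congr rfl fun r _ => ?_
    rw [card_filter]
    push_cast
    rfl
  -- the left-hand count is the second moment of `S = F · Σ_r G_r`
  have hLcount : (q : ℝ) * ((((BY ×ˢ (BR ×ˢ BS)) ×ˢ (BY ×ˢ (BR ×ˢ BS))).filter
      (fun t => φ t.1.1 + ψ t.1.2.1 t.1.2.2 = φ t.2.1 + ψ t.2.2.1 t.2.2.2)).card : ℝ) =
      ∑ a ∈ range q, ‖F a * ∑ r ∈ BR, G a r‖ ^ 2 := by
    rw [show (((BY ×ˢ (BR ×ˢ BS)) ×ˢ (BY ×ˢ (BR ×ˢ BS))).filter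
        (fun t => φ t.1.1 + ψ t.1.2.1 t.1.2.2 = φ t.2.1 + ψ t.2.2.1 t.2.2.2)) =
        ((BY ×ˢ (BR ×ˢ BS)) ×ˢ (BY ×ˢ (BR ×ˢ BS))).filter (fun p => u p.1 = u p.2) from rfl, ← hL]
    exact sum_congr rfl fun a _ => by rw [hS a]
  -- assemble
  have hq' : (0 : ℝ) < q := by exact_mod_cast hq
  have key : (q : ℝ) * ((((BY ×ˢ (BR ×ˢ BS)) ×ˢ (BY ×ˢ (BR ×ˢ BS))).filter
      (fun t => φ t.1.1 + ψ t.1.2.1 t.1.2.2 = φ t.2.1 + ψ t.2.2.1 t.2.2.2)).card : ℝ) ≤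
      (q : ℝ) * (BR.card * (((BR ×ˢ ((BY ×ˢ BS) ×ˢ (BY ×ˢ BS))).filter
        (fun t => φ t.2.1.1 + ψ t.1 t.2.1.2 = φ t.2.2.1 + ψ t.1 t.2.2.2)).card : ℝ)) := by
    rw [hLcount, hRcount, mul_sum, mul_sum]
    calc ∑ a ∈ range q, ‖F a * ∑ r ∈ BR, G a r‖ ^ 2
        ≤ ∑ a ∈ range q, (BR.card : ℝ) * ∑ r ∈ BR, ‖F a * G a r‖ ^ 2 := sum_le_sum fun a _ => hCS a
      _ = (BR.card : ℝ) * ∑ r ∈ BR, ∑ a ∈ range q, ‖F a * G a r‖ ^ 2 := by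
          rw [← mul_sum, sum_comm]
      _ = (BR.card : ℝ) * ∑ r ∈ BR, (q : ℝ) *
            ((((BY ×ˢ BS) ×ˢ (BY ×ˢ BS)).filter (fun p => u' r p.1 = u' r p.2)).card : ℝ) := by
          rw [sum_congr rfl hRr]
      _ = ∑ r ∈ BR, (q : ℝ) * ((BR.card : ℝ) *
            ((((BY ×ˢ BS) ×ˢ (BY ×ˢ BS)).filter (fun p => u' r p.1 = u' r p.2)).card : ℝ)) := by
          rw [mul_sum]; exact sum_congr rfl fun r _ => by ring
  have key' := le_of_mul_le_mul_left key hq'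
  exact_mod_cast key'

end FourierCount

end Literature.NumberTheory.DiophantineGeometry
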